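import Mathlib.Analysis.SpecialFunctions.Trigonometric.Deriv
import Mathlib.Analysis.SpecialFunctions.Trigonometric.Angle
import Mathlib.Analysis.SpecialFunctions.Complex.Arg
import Mathlib.Analysis.Calculus.Deriv.Shift
import Mathlib.Analysis.Calculus.ContDiff.Deriv
import Mathlib.Analysis.Calculus.MeanValue
import Mathlib.MeasureTheory.Integral.IntervalIntegral.FundThmCalculus
import HarnessLib

/-!
# Smooth angle functions of smooth closed curves on the circle; the degree

Topic `Literature/Topology/FourManifolds` (elementary calculus, used for framings of tubular
neighbourhoods of knots). Let `(c, s) : ℝ → S¹ ⊆ ℝ²` be differentiable with `c² + s² = 1`. We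
construct an **angle function** (lift through `θ ↦ (cos θ, sin θ)`) explicitly, with no
covering-space theory, by integrating the angular velocity:

* `Literature.AngleLift.angVel c s = c s' - s c'`, `Literature.AngleLift.angleFun c s a₀ θ = a₀ + ∫₀^θ angVel`;
* `Literature.Topology.FourManifolds.AngleLift.cos_angleFun`, `sin_angleFun` — if `(cos a₀, sin a₀) = (c 0, s 0)` then
  `(cos, sin) ∘ angleFun = (c, s)` (the frame coordinates `c cos α + s sin α`, `s cos α - c sin α`
  have zero derivative);
* `Literature.Topology.FourManifolds.AngleLift.contDiff_angleFun` — the angle function of a `C^∞` curve is `C^∞`;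
* `Literature.Topology.FourManifolds.AngleLift.exists_int_angleFun_add_period` — for a `T`-periodic curve there is an integer
  `d`, the **degree**, with `angleFun (θ + T) = angleFun θ + 2π d` for all `θ`;
* `Literature.Topology.FourManifolds.exists_contDiff_angle_periodic` — packaged: every `C^∞` `T`-periodic curve on the unit
  circle is `(cos α, sin α)` for a `C^∞` function `α` with `α (θ + T) = α θ + 2π d`, `d ∈ ℤ`.

This is the classical computation of the degree (winding number) of a closed curve
`S¹ → S¹` as `(2π)⁻¹ ∮ (c ds - s dc)` (e.g. M. P. do Carmo, *Differential Geometry of Curves and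
Surfaces* (1976), §1.7 and §5.7, Lemma 1 and the definition of the rotation index; H. Hopf,
*Über die Drehung der Tangenten und Sehnen ebener Kurven*, Compositio Math. 2 (1935)).

## References

* M. P. do Carmo, *Differential Geometry of Curves and Surfaces*, Prentice-Hall (1976), §5.7,
  Lemma 1 (differentiable angle functions exist). [folklore]
-/

noncomputable section

open Set Function Real intervalIntegral
open scoped Topology ContDiff

namespace Literature.Topology.FourManifolds

namespace AngleLift

variable (c s : ℝ → ℝ)

/-- The **angular velocity** `c s' - s c'` of the plane curve `(c, s)`. [folklore] -/
def angVel (θ : ℝ) : ℝ := c θ * deriv s θ - s θ * deriv c θ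

/-- The **angle function** with initial value `a₀`: `a₀ + ∫₀^θ (c s' - s c')`. [folklore] -/
def angleFun (a₀ : ℝ) (θ : ℝ) : ℝ := a₀ + ∫ t in (0 : ℝ)..θ, angVel c s t

variable {c s}

/-- The angle function starts at `a₀`. [folklore] -/
@[simp] theorem angleFun_zero (a₀ : ℝ) : angleFun c s a₀ 0 = a₀ := by simp [angleFun]

/-- The angular velocity of a `C¹` curve is continuous. [folklore] -/
theorem continuous_angVel (hc : ContDiff ℝ 1 c) (hs : ContDiff ℝ 1 s) :
    Continuous (angVel c s) :=
  (hc.continuous.mul (hs.continuous_deriv le_rfl)).sub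
    (hs.continuous.mul (hc.continuous_deriv le_rfl))

/-- The angular velocity of a `C^∞` curve is `C^∞`. [folklore] -/
theorem contDiff_angVel (hc : ContDiff ℝ ∞ c) (hs : ContDiff ℝ ∞ s) :
    ContDiff ℝ ∞ (angVel c s) :=
  (hc.mul (contDiff_infty_iff_deriv.1 hs).2).sub (hs.mul (contDiff_infty_iff_deriv.1 hc).2)

/-- **The derivative of the angle function is the angular velocity** (fundamental theorem of
calculus). [folklore] -/
theorem hasDerivAt_angleFun (hc : ContDiff ℝ 1 c) (hs : ContDiff ℝ 1 s) (a₀ θ : ℝ) :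
    HasDerivAt (angleFun c s a₀) (angVel c s θ) θ := by
  have hcont := continuous_angVel hc hs
  have h := integral_hasDerivAt_right (hcont.intervalIntegrable 0 θ)
    (hcont.stronglyMeasurableAtFilter _ _) hcont.continuousAt
  have hdef : angleFun c s a₀ = fun θ => a₀ + ∫ t in (0 : ℝ)..θ, angVel c s t := rfl
  rw [hdef]
  exact h.const_add a₀

/-- The angle function is differentiable. [folklore] -/
theorem differentiable_angleFun (hc : ContDiff ℝ 1 c) (hs : ContDiff ℝ 1 s) (a₀ : ℝ) :
    Differentiable ℝ (angleFun c s a₀) := fun θ =>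
  (hasDerivAt_angleFun hc hs a₀ θ).differentiableAt

/-- The derivative of the angle function. [folklore] -/
theorem deriv_angleFun (hc : ContDiff ℝ 1 c) (hs : ContDiff ℝ 1 s) (a₀ : ℝ) :
    deriv (angleFun c s a₀) = angVel c s :=
  funext fun θ => (hasDerivAt_angleFun hc hs a₀ θ).deriv

/-- **The angle function of a `C^∞` curve is `C^∞`.** [folklore] -/
theorem contDiff_angleFun (hc : ContDiff ℝ ∞ c) (hs : ContDiff ℝ ∞ s) (a₀ : ℝ) :
    ContDiff ℝ ∞ (angleFun c s a₀) := by
  rw [contDiff_infty_iff_deriv, deriv_angleFun (hc.of_le (mod_cast le_top)) (hs.of_le (mod_cast le_top))]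
  exact ⟨differentiable_angleFun (hc.of_le (mod_cast le_top)) (hs.of_le (mod_cast le_top)) a₀,
    contDiff_angVel hc hs⟩

/-- On the unit circle, position and velocity are orthogonal: `c c' + s s' = 0`. [folklore] -/
theorem mul_deriv_add_mul_deriv_eq_zero (hc : Differentiable ℝ c) (hs : Differentiable ℝ s)
    (h1 : ∀ θ, c θ ^ 2 + s θ ^ 2 = 1) (θ : ℝ) :
    c θ * deriv c θ + s θ * deriv s θ = 0 := by
  have hd : HasDerivAt (fun θ => c θ * c θ + s θ * s θ)
      (2 * c θ * deriv c θ + 2 * s θ * deriv s θ) θ :=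
    (((hc θ).hasDerivAt.mul (hc θ).hasDerivAt).add
      ((hs θ).hasDerivAt.mul (hs θ).hasDerivAt)).congr_deriv (by ring)
  have hconst : HasDerivAt (fun θ => c θ * c θ + s θ * s θ) 0 θ := by
    have : (fun θ => c θ * c θ + s θ * s θ) = fun _ => (1 : ℝ) :=
      funext fun θ => by rw [← sq, ← sq]; exact h1 θ
    rw [this]
    exact hasDerivAt_const θ 1
  have := hd.unique hconst
  linarith

/-- **The angle function is an angle function**: if `(cos a₀, sin a₀) = (c 0, s 0)` then
`cos (angleFun θ) = c θ` and `sin (angleFun θ) = s θ` for all `θ`. Proof: the coordinates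
`A = c cos α + s sin α`, `B = s cos α - c sin α` of `(c, s)` in the rotating frame satisfy
`A' = B' = 0` (using `c c' + s s' = 0` and `α' = c s' - s c'`), so `A ≡ 1`, `B ≡ 0`. [folklore] -/
theorem cos_angleFun_and_sin_angleFun (hc : ContDiff ℝ 1 c) (hs : ContDiff ℝ 1 s)
    (h1 : ∀ θ, c θ ^ 2 + s θ ^ 2 = 1) {a₀ : ℝ} (h0c : Real.cos a₀ = c 0) (h0s : Real.sin a₀ = s 0)
    (θ : ℝ) : Real.cos (angleFun c s a₀ θ) = c θ ∧ Real.sin (angleFun c s a₀ θ) = s θ := by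
  set α := angleFun c s a₀ with hα
  have hcd : Differentiable ℝ c := hc.differentiable one_ne_zero
  have hsd : Differentiable ℝ s := hs.differentiable one_ne_zero
  have hαd : ∀ x, HasDerivAt α (angVel c s x) x := hasDerivAt_angleFun hc hs a₀
  have hcosd : ∀ x, HasDerivAt (fun x => Real.cos (α x)) (-Real.sin (α x) * angVel c s x) x :=
    fun x => (Real.hasDerivAt_cos _).comp x (hαd x)
  have hsind : ∀ x, HasDerivAt (fun x => Real.sin (α x)) (Real.cos (α x) * angVel c s x) x :=
    fun x => (Real.hasDerivAt_sin _).comp x (hαd x)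
  -- the frame coordinates
  set A : ℝ → ℝ := fun x => c x * Real.cos (α x) + s x * Real.sin (α x) with hA
  set B : ℝ → ℝ := fun x => s x * Real.cos (α x) - c x * Real.sin (α x) with hB
  have horth := mul_deriv_add_mul_deriv_eq_zero hcd hsd h1
  -- the algebra: `c' + s α' = c (c c' + s s') = 0`, `s' - c α' = s (c c' + s s') = 0`
  have key : ∀ x, deriv c x + s x * angVel c s x = 0 := fun x => by
    have e2 := h1 x
    have : deriv c x + s x * angVel c s x = c x * (c x * deriv c x + s x * deriv s x) := by
      simp only [angVel]; linear_combination (-deriv c x) * e2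
    rw [this, horth x, mul_zero]
  have key' : ∀ x, deriv s x - c x * angVel c s x = 0 := fun x => by
    have e2 := h1 x
    have : deriv s x - c x * angVel c s x = s x * (c x * deriv c x + s x * deriv s x) := by
      simp only [angVel]; linear_combination (-deriv s x) * e2
    rw [this, horth x, mul_zero]
  have hA' : ∀ x, HasDerivAt A 0 x := by
    intro x
    have h := ((hcd x).hasDerivAt.mul (hcosd x)).add ((hsd x).hasDerivAt.mul (hsind x))
    refine h.congr_deriv ?_
    linear_combination (Real.cos (α x)) * key x + (Real.sin (α x)) * key' x
  have hB' : ∀ x, HasDerivAt B 0 x := by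
    intro x
    have h := ((hsd x).hasDerivAt.mul (hcosd x)).sub ((hcd x).hasDerivAt.mul (hsind x))
    refine h.congr_deriv ?_
    linear_combination (-Real.sin (α x)) * key x + (Real.cos (α x)) * key' x
  have hα0 : α 0 = a₀ := by rw [hα]; exact angleFun_zero a₀
  have hAc : A θ = 1 := by
    have hconst := is_const_of_deriv_eq_zero (fun x => (hA' x).differentiableAt)
      (fun x => (hA' x).deriv) θ 0
    rw [hconst]
    show c 0 * Real.cos (α 0) + s 0 * Real.sin (α 0) = 1
    rw [hα0, h0c, h0s]
    nlinarith [h1 0]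
  have hBc : B θ = 0 := by
    have hconst := is_const_of_deriv_eq_zero (fun x => (hB' x).differentiableAt)
      (fun x => (hB' x).deriv) θ 0
    rw [hconst]
    show s 0 * Real.cos (α 0) - c 0 * Real.sin (α 0) = 0
    rw [hα0, h0c, h0s]
    ring
  -- invert the rotation
  have hcos2 := Real.cos_sq_add_sin_sq (α θ)
  change c θ * Real.cos (α θ) + s θ * Real.sin (α θ) = 1 at hAc
  change s θ * Real.cos (α θ) - c θ * Real.sin (α θ) = 0 at hBc
  constructor
  · linear_combination (-Real.cos (α θ)) * hAc + Real.sin (α θ) * hBc + c θ * hcos2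
  · linear_combination (-Real.sin (α θ)) * hAc - Real.cos (α θ) * hBc + s θ * hcos2

/-- `cos ∘ angleFun = c`. [folklore] -/
theorem cos_angleFun (hc : ContDiff ℝ 1 c) (hs : ContDiff ℝ 1 s)
    (h1 : ∀ θ, c θ ^ 2 + s θ ^ 2 = 1) {a₀ : ℝ} (h0c : Real.cos a₀ = c 0) (h0s : Real.sin a₀ = s 0)
    (θ : ℝ) : Real.cos (angleFun c s a₀ θ) = c θ :=
  (cos_angleFun_and_sin_angleFun hc hs h1 h0c h0s θ).1

/-- `sin ∘ angleFun = s`. [folklore] -/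
theorem sin_angleFun (hc : ContDiff ℝ 1 c) (hs : ContDiff ℝ 1 s)
    (h1 : ∀ θ, c θ ^ 2 + s θ ^ 2 = 1) {a₀ : ℝ} (h0c : Real.cos a₀ = c 0) (h0s : Real.sin a₀ = s 0)
    (θ : ℝ) : Real.sin (angleFun c s a₀ θ) = s θ :=
  (cos_angleFun_and_sin_angleFun hc hs h1 h0c h0s θ).2

/-- The derivative of a periodic function is periodic. [folklore] -/
theorem deriv_periodic {f : ℝ → ℝ} {T : ℝ} (hf : Periodic f T) : Periodic (deriv f) T := by
  intro x
  have h : deriv (fun y => f (y + T)) x = deriv f (x + T) := deriv_comp_add_const f T x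
  rw [← h]
  congr 1
  exact funext hf

/-- The angular velocity of a periodic curve is periodic. [folklore] -/
theorem periodic_angVel {T : ℝ} (hcT : Periodic c T) (hsT : Periodic s T) :
    Periodic (angVel c s) T := fun x => by
  simp only [angVel, hcT x, hsT x, deriv_periodic hcT x, deriv_periodic hsT x]

/-- The increment `angleFun (θ + T) - angleFun θ` of the angle function of a `T`-periodic curve
does not depend on `θ` (its derivative `angVel (θ + T) - angVel θ` vanishes). [folklore] -/
theorem angleFun_add_period_sub (hc : ContDiff ℝ 1 c) (hs : ContDiff ℝ 1 s) {T : ℝ}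
    (hcT : Periodic c T) (hsT : Periodic s T) (a₀ θ : ℝ) :
    angleFun c s a₀ (θ + T) - angleFun c s a₀ θ = angleFun c s a₀ T - a₀ := by
  have hd : ∀ x, HasDerivAt (fun x => angleFun c s a₀ (x + T) - angleFun c s a₀ x) 0 x := by
    intro x
    have h1 := (hasDerivAt_angleFun hc hs a₀ (x + T)).comp_add_const x T
    have h2 := hasDerivAt_angleFun hc hs a₀ x
    have h3 := h1.sub h2
    rw [periodic_angVel hcT hsT x, sub_self] at h3
    exact h3
  have := is_const_of_deriv_eq_zero (fun x => (hd x).differentiableAt) (fun x => (hd x).deriv) θ 0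
  simpa using this

/-- **The degree of a periodic curve on the circle.** For a `T`-periodic `C¹` curve `(c, s)` on the
unit circle and an angle function with `(cos a₀, sin a₀) = (c 0, s 0)` there is an integer `d`
with `angleFun (θ + T) = angleFun θ + 2π d` for all `θ`. [folklore] -/
theorem exists_int_angleFun_add_period (hc : ContDiff ℝ 1 c) (hs : ContDiff ℝ 1 s)
    (h1 : ∀ θ, c θ ^ 2 + s θ ^ 2 = 1) {T : ℝ} (hcT : Periodic c T) (hsT : Periodic s T) {a₀ : ℝ}
    (h0c : Real.cos a₀ = c 0) (h0s : Real.sin a₀ = s 0) :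
    ∃ d : ℤ, ∀ θ, angleFun c s a₀ (θ + T) = angleFun c s a₀ θ + 2 * π * d := by
  -- the angles `angleFun T` and `a₀` have the same cosine and sine
  have hcosT : Real.cos (angleFun c s a₀ T) = Real.cos a₀ := by
    rw [cos_angleFun hc hs h1 h0c h0s, h0c, ← hcT 0, zero_add]
  have hsinT : Real.sin (angleFun c s a₀ T) = Real.sin a₀ := by
    rw [sin_angleFun hc hs h1 h0c h0s, h0s, ← hsT 0, zero_add]
  obtain ⟨d, hd⟩ := Real.Angle.angle_eq_iff_two_pi_dvd_sub.1 (Real.Angle.cos_sin_inj hcosT hsinT)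
  refine ⟨d, fun θ => ?_⟩
  have h := angleFun_add_period_sub hc hs hcT hsT a₀ θ
  linarith

end AngleLift

/-- **Smooth angle functions of smooth closed curves on the circle.** Let `(c, s) : ℝ → ℝ²` be
`C^∞` and `T`-periodic with `c² + s² = 1`. Then there are a `C^∞` function `α : ℝ → ℝ` and an
integer `d` (the degree of the closed curve `ℝ/Tℤ → S¹`) with `c = cos ∘ α`, `s = sin ∘ α` and
`α (θ + T) = α θ + 2π d` for all `θ` (do Carmo, *Differential Geometry of Curves and Surfaces*
(1976), §5.7, Lemma 1; the lift is `a₀ + ∫₀ (c s' - s c')`). [folklore] -/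
theorem exists_contDiff_angle_periodic {c s : ℝ → ℝ} (hc : ContDiff ℝ ∞ c) (hs : ContDiff ℝ ∞ s)
    (h1 : ∀ θ, c θ ^ 2 + s θ ^ 2 = 1) {T : ℝ} (hcT : Periodic c T) (hsT : Periodic s T) :
    ∃ (α : ℝ → ℝ) (d : ℤ), ContDiff ℝ ∞ α ∧ (∀ θ, Real.cos (α θ) = c θ) ∧
      (∀ θ, Real.sin (α θ) = s θ) ∧ ∀ θ, α (θ + T) = α θ + 2 * π * d := by
  -- an initial angle: the argument of the unit complex number `c 0 + i s 0`
  set z : ℂ := ⟨c 0, s 0⟩ with hz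
  have hz1 : ‖z‖ = 1 := by
    rw [Complex.norm_def, Complex.normSq_mk, ← sq, ← sq, h1 0, Real.sqrt_one]
  have hz0 : z ≠ 0 := fun h => by rw [h] at hz1; simp at hz1
  set a₀ := Complex.arg z with ha₀
  have h0c : Real.cos a₀ = c 0 := by
    rw [ha₀, Complex.cos_arg hz0, hz1, div_one]
  have h0s : Real.sin a₀ = s 0 := by
    rw [ha₀, Complex.sin_arg, hz1, div_one]
  have hc1 : ContDiff ℝ 1 c := hc.of_le (mod_cast le_top)
  have hs1 : ContDiff ℝ 1 s := hs.of_le (mod_cast le_top)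
  obtain ⟨d, hd⟩ := AngleLift.exists_int_angleFun_add_period hc1 hs1 h1 hcT hsT h0c h0s
  exact ⟨AngleLift.angleFun c s a₀, d, AngleLift.contDiff_angleFun hc hs a₀,
    AngleLift.cos_angleFun hc1 hs1 h1 h0c h0s, AngleLift.sin_angleFun hc1 hs1 h1 h0c h0s, hd⟩

end Literature.Topology.FourManifolds

end
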